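import Summits.AnomalousDissipation.AnomalousDissipation.Theses.EnsembleRigidity
import Summits.AnomalousDissipation.AnomalousDissipation.Theorems.TaylorCertificatePair.Negative.Bounds

/-!
# Load-bearing hypotheses and the `R = 0` kill switch of `EnsembleRigidity.GPStatisticalRigidity`
# (stmt-AnomalousDissipation-15508) — negative side

cdisprove seat `refuter-cdisprove-stmt-AnomalousDissipation-15508-0` (2026-08-16). Kernel-checked negative knowledge
about the crux STATISTICAL LAMB RIGIDITY OF `f_GP`; nothing here asserts a Theses statement.

* `RigidAt f E c δ₀` — the `∀ μ …` body of the crux; `rigid_of_crux` projects the crux onto it at the pinned force.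
* `gpStatisticalRigidity_false_without_prob` — with `IsProbabilityMeasure μ` deleted the ZERO MEASURE meets every other
  hypothesis at every `R ≥ 0` and the conclusion reads `c ≤ 0`: any proof must use the mass normalisation (it fixes the
  scale: under `μ ↦ λμ`, `R ↦ √λ R` and `R√G ↦ λ R√G`).
* `gpStatisticalRigidity_false_without_defect` — with the cylindrical forced-Euler defect clause deleted the Dirac mass
  AT REST (energy, enstrophy and shell work all `0`) meets the rest and `R = 0` gives `c ≤ 0`.
* `not_gpStatisticalRigidity_of_exactEulerStatistics`, `not_gpStatisticalRigidity_of_dodgerState` — the `R = 0`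
  instance of the crux, isolated: ONE exact finite-enstrophy stationary forced-Euler statistics of `f_GP` with
  non-negative shell work (in particular the Dirac mass at ONE exact dodger state `u ∈ H`, `‖∇u‖ < ∞`, `(u,f_GP) ≥ 0`,
  `⟨f_GP − B(u,u), Φ'(u)⟩ = 0 ∀Φ`) refutes the crux AT ANY ENERGY (the crux quantifies over all levels `E`).
* `rigidAt_anti`, `rigidAt_of_neg` — constants for level `E` serve all `E' ≤ E`; negative levels are vacuous.
-/

noncomputable section

open MeasureTheory UnitAddTorus
open scoped InnerProductSpace ENNReal

namespace Summit.AnomalousDissipation.AnomalousDissipation.Theorems.GPStatisticalRigidity.Negative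

open Literature.Analysis.FunctionSpaces Literature.Analysis.FluidPDE
open Summit.AnomalousDissipation.AnomalousDissipation.Theses.EnsembleRigidity
open Summit.AnomalousDissipation.AnomalousDissipation.Theorems.TaylorCertificatePair.Negative


set_option linter.dupNamespace false

/-- Singletons of `H` are measurable (Borel σ-algebra of a metric space); registered locally because instance
search times out on the subtype. -/
instance instMeasurableSingletonClassH : MeasurableSingletonClass (Torus.energySpace (Fin 3)) :=
  OpensMeasurableSpace.toMeasurableSingletonClass

/-! ## §1 The pinned force and the body of the crux -/

/-- The Galloway–Proctor force `f_GP = sin(2πx₂)e₀ + sin(2πx₀)e₁ + sin(2πx₁)e₂`, byte-identical to the crux. -/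
def gpForce : (UnitAddTorus (Fin 3)) → (EuclideanSpace ℝ (Fin 3)) := fun x : UnitAddTorus (Fin 3) =>
  (Literature.Analysis.FluidPDE.Torus.stokesMode (Pi.single (2 : Fin 3) (1 : ℤ)) (EuclideanSpace.single (0 : Fin 3) (1 : ℝ)) false x +
    Literature.Analysis.FluidPDE.Torus.stokesMode (Pi.single (0 : Fin 3) (1 : ℤ)) (EuclideanSpace.single (1 : Fin 3) (1 : ℝ)) false x +
    Literature.Analysis.FluidPDE.Torus.stokesMode (Pi.single (1 : Fin 3) (1 : ℤ)) (EuclideanSpace.single (2 : Fin 3) (1 : ℝ)) false x : EuclideanSpace ℝ (Fin 3))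

/-- Non-negative work on every energy shell (hypothesis 5 of the crux). -/
def ShellWorkNonneg (f : (UnitAddTorus (Fin 3)) → (EuclideanSpace ℝ (Fin 3))) (μ : Measure (Torus.energySpace (Fin 3))) : Prop :=
  ∀ e₁ e₂ : ℝ≥0∞, e₁ < e₂ →
    0 ≤ ∫ v in {v : (Torus.energySpace (Fin 3)) | e₁ ≤ ‖v‖ₑ ^ 2 ∧ ‖v‖ₑ ^ 2 < e₂}, Torus.pairing (v : Lp (EuclideanSpace ℝ (Fin 3)) 2 (volume : Measure (UnitAddTorus (Fin 3)))) f ∂μ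

/-- The cylindrical forced-Euler defect bound with constant `R` (hypothesis 6 of the crux). -/
def DefectLE (f : (UnitAddTorus (Fin 3)) → (EuclideanSpace ℝ (Fin 3))) (μ : Measure (Torus.energySpace (Fin 3))) (R : ℝ) : Prop :=
  ∀ Φ : Torus.CylindricalTest (Fin 3),
    Integrable (fun v : (Torus.energySpace (Fin 3)) => Torus.nsGeneratorPairing 0 f v (Φ.grad v)) μ ∧
      |∫ v, Torus.nsGeneratorPairing 0 f v (Φ.grad v) ∂μ| ≤ R * Real.sqrt (∫ v, Torus.gradNormSq (Φ.grad v) ∂μ)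

/-- The `∀ μ`-body of the crux at force `f`, level `E`, constants `c, δ₀`. -/
def RigidAt (f : (UnitAddTorus (Fin 3)) → (EuclideanSpace ℝ (Fin 3))) (E c δ₀ : ℝ) : Prop :=
  ∀ μ : Measure (Torus.energySpace (Fin 3)), IsProbabilityMeasure μ → Integrable (fun v : (Torus.energySpace (Fin 3)) => ‖v‖ ^ 2) μ →
    Torus.ensembleEnergy μ ≤ E → Torus.ensembleEnstrophy μ < ⊤ → ShellWorkNonneg f μ →
      ∀ R : ℝ, 0 ≤ R → R ≤ δ₀ → DefectLE f μ R → c ≤ R * Real.sqrt (Torus.ensembleEnstrophy μ).toReal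

/-- The crux, unfolded: constants `c(E), δ₀(E) > 0` with `RigidAt f_GP E c δ₀` at every level. -/
theorem rigid_of_crux (h : GPStatisticalRigidity) (E : ℝ) : ∃ c δ₀ : ℝ, 0 < c ∧ 0 < δ₀ ∧ RigidAt gpForce E c δ₀ :=
  h gpForce rfl E

/-! ## §2 Load-bearing: the probability normalisation -/

/-- The crux with `IsProbabilityMeasure μ` DELETED (everything else verbatim). -/
def GPStatisticalRigidityWithoutProb : Prop :=
  ∀ E : ℝ, ∃ c δ₀ : ℝ, 0 < c ∧ 0 < δ₀ ∧
    ∀ μ : Measure (Torus.energySpace (Fin 3)), Integrable (fun v : (Torus.energySpace (Fin 3)) => ‖v‖ ^ 2) μ →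
      Torus.ensembleEnergy μ ≤ E → Torus.ensembleEnstrophy μ < ⊤ → ShellWorkNonneg gpForce μ →
        ∀ R : ℝ, 0 ≤ R → R ≤ δ₀ → DefectLE gpForce μ R → c ≤ R * Real.sqrt (Torus.ensembleEnstrophy μ).toReal

/-- **Any proof must use the probability normalisation**: the zero measure kills the un-normalised statement
(level `E = 0`, any admissible `R`, here `R = δ₀`). -/
theorem gpStatisticalRigidity_false_without_prob : ¬ GPStatisticalRigidityWithoutProb := by
  intro h
  obtain ⟨c, δ₀, hc, hδ₀, hall⟩ := h 0
  have hE : Torus.ensembleEnergy (0 : Measure (Torus.energySpace (Fin 3))) ≤ 0 := by simp [Torus.ensembleEnergy]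
  have hG : Torus.ensembleEnstrophy (0 : Measure (Torus.energySpace (Fin 3))) < ⊤ := by simp [Torus.ensembleEnstrophy]
  have hS : ShellWorkNonneg gpForce (0 : Measure (Torus.energySpace (Fin 3))) := fun e₁ e₂ _ => by simp
  have hD : DefectLE gpForce (0 : Measure (Torus.energySpace (Fin 3))) δ₀ := fun Φ => ⟨integrable_zero_measure, by simp⟩
  have key := hall 0 integrable_zero_measure hE hG hS δ₀ hδ₀.le le_rfl hD
  have : Real.sqrt (Torus.ensembleEnstrophy (0 : Measure (Torus.energySpace (Fin 3)))).toReal = 0 := by simp [Torus.ensembleEnstrophy]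
  rw [this, mul_zero] at key
  exact absurd key (not_le.mpr hc)

/-! ## §3 Load-bearing: the defect clause -/

/-- The crux with the cylindrical forced-Euler DEFECT CLAUSE DELETED (everything else verbatim). -/
def GPStatisticalRigidityWithoutDefect : Prop :=
  ∀ E : ℝ, ∃ c δ₀ : ℝ, 0 < c ∧ 0 < δ₀ ∧
    ∀ μ : Measure (Torus.energySpace (Fin 3)), IsProbabilityMeasure μ → Integrable (fun v : (Torus.energySpace (Fin 3)) => ‖v‖ ^ 2) μ →
      Torus.ensembleEnergy μ ≤ E → Torus.ensembleEnstrophy μ < ⊤ → ShellWorkNonneg gpForce μ →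
        ∀ R : ℝ, 0 ≤ R → R ≤ δ₀ → c ≤ R * Real.sqrt (Torus.ensembleEnstrophy μ).toReal

/-- The mean enstrophy of the Dirac mass at rest vanishes. -/
theorem ensembleEnstrophy_dirac_zero : Torus.ensembleEnstrophy (Measure.dirac (0 : (Torus.energySpace (Fin 3)))) = 0 := by
  unfold Torus.ensembleEnstrophy
  rw [lintegral_dirac]
  exact eGradNormSq_coe_zero

/-- The state of rest does no work against any force: `(0, f) = 0`. -/
theorem pairing_zero_state (f : (UnitAddTorus (Fin 3)) → (EuclideanSpace ℝ (Fin 3))) : Torus.pairing ((0 : (Torus.energySpace (Fin 3))) : Lp (EuclideanSpace ℝ (Fin 3)) 2 (volume : Measure (UnitAddTorus (Fin 3)))) f = 0 := by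
  rw [pairing_of_ae coe_zero_ae]
  simp

/-- The same with the coercion `((0 : (Torus.energySpace (Fin 3))) : L²) = 0` already simplified. -/
theorem pairing_zero_L2 (f : (UnitAddTorus (Fin 3)) → (EuclideanSpace ℝ (Fin 3))) : Torus.pairing (0 : Lp (EuclideanSpace ℝ (Fin 3)) 2 (volume : Measure (UnitAddTorus (Fin 3)))) f = 0 := by
  have h := pairing_zero_state f
  rwa [Submodule.coe_zero] at h

/-- The Dirac mass at rest has non-negative (indeed zero) work on every shell. -/
theorem shellWorkNonneg_dirac_zero (f : (UnitAddTorus (Fin 3)) → (EuclideanSpace ℝ (Fin 3))) : ShellWorkNonneg f (Measure.dirac (0 : (Torus.energySpace (Fin 3)))) := by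
  intro e₁ e₂ _
  refine integral_nonneg_of_ae ?_
  refine ae_restrict_of_ae ?_
  filter_upwards [ae_eq_dirac (fun v : (Torus.energySpace (Fin 3)) => Torus.pairing (v : Lp (EuclideanSpace ℝ (Fin 3)) 2 (volume : Measure (UnitAddTorus (Fin 3)))) f)] with v hv
  rw [hv]
  simp [pairing_zero_L2]

/-- **Any proof must use the defect clause**: the Dirac mass at rest kills the statement without it
(level `E = 0`, `R = 0`). -/
theorem gpStatisticalRigidity_false_without_defect : ¬ GPStatisticalRigidityWithoutDefect := by
  intro h
  obtain ⟨c, δ₀, hc, hδ₀, hall⟩ := h 0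
  have hI : Integrable (fun v : (Torus.energySpace (Fin 3)) => ‖v‖ ^ 2) (Measure.dirac (0 : (Torus.energySpace (Fin 3)))) :=
    (integrable_const (‖(0 : (Torus.energySpace (Fin 3)))‖ ^ 2)).congr (ae_eq_dirac (fun v : (Torus.energySpace (Fin 3)) => ‖v‖ ^ 2)).symm
  have hE : Torus.ensembleEnergy (Measure.dirac (0 : (Torus.energySpace (Fin 3)))) ≤ 0 := by
    unfold Torus.ensembleEnergy
    rw [integral_dirac]
    simp
  have hG : Torus.ensembleEnstrophy (Measure.dirac (0 : (Torus.energySpace (Fin 3)))) < ⊤ := by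
    rw [ensembleEnstrophy_dirac_zero]; exact ENNReal.zero_lt_top
  have key := hall _ inferInstance hI hE hG (shellWorkNonneg_dirac_zero gpForce) 0 le_rfl hδ₀.le
  rw [zero_mul] at key
  exact absurd key (not_le.mpr hc)

/-! ## §4 The `R = 0` kill switch: exact forced-Euler statistics / exact dodgers -/

/-- An EXACT finite-enstrophy stationary forced-Euler statistics of `f` in the sense of the crux: a Borel
probability measure on `H` with integrable energy, finite mean enstrophy, non-negative shell work and vanishing
cylindrical forced-Euler defect `∫⟨f − B(v,v), Φ'(v)⟩dμ = 0`. (For `f = f_GP` none is known at any energy.) -/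
def ExactEulerStatistics (f : (UnitAddTorus (Fin 3)) → (EuclideanSpace ℝ (Fin 3))) (μ : Measure (Torus.energySpace (Fin 3))) : Prop :=
  IsProbabilityMeasure μ ∧ Integrable (fun v : (Torus.energySpace (Fin 3)) => ‖v‖ ^ 2) μ ∧ Torus.ensembleEnstrophy μ < ⊤ ∧
    ShellWorkNonneg f μ ∧
      ∀ Φ : Torus.CylindricalTest (Fin 3),
        Integrable (fun v : (Torus.energySpace (Fin 3)) => Torus.nsGeneratorPairing 0 f v (Φ.grad v)) μ ∧
          ∫ v, Torus.nsGeneratorPairing 0 f v (Φ.grad v) ∂μ = 0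

/-- An exact statistics has defect `≤ R·(…)` for every `R ≥ 0`, in particular for `R = 0`. -/
theorem defectLE_of_exact {f : (UnitAddTorus (Fin 3)) → (EuclideanSpace ℝ (Fin 3))} {μ : Measure (Torus.energySpace (Fin 3))} (h : ExactEulerStatistics f μ) {R : ℝ} (hR : 0 ≤ R) :
    DefectLE f μ R := fun Φ =>
  ⟨(h.2.2.2.2 Φ).1, by
    rw [(h.2.2.2.2 Φ).2, abs_zero]
    exact mul_nonneg hR (Real.sqrt_nonneg _)⟩

/-- **Kill switch (measures).** One exact finite-enstrophy forced-Euler statistics of `f_GP` with non-negative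
shell work — at ANY energy — refutes the crux: at its own level `E = e(μ)` take `R = 0`. -/
theorem not_gpStatisticalRigidity_of_exactEulerStatistics (hex : ∃ μ : Measure (Torus.energySpace (Fin 3)), ExactEulerStatistics gpForce μ) :
    ¬ GPStatisticalRigidity := by
  rintro h
  obtain ⟨μ, hμ⟩ := hex
  obtain ⟨c, δ₀, hc, hδ₀, hall⟩ := rigid_of_crux h (Torus.ensembleEnergy μ)
  have key := hall μ hμ.1 hμ.2.1 le_rfl hμ.2.2.1 hμ.2.2.2.1 0 le_rfl hδ₀.le (defectLE_of_exact hμ le_rfl)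
  rw [zero_mul] at key
  exact absurd key (not_le.mpr hc)

/-- An EXACT DODGER STATE of `f`: `u ∈ H` with finite enstrophy, non-negative work `(u, f) ≥ 0`, and
`⟨f − B(u,u), Φ'(u)⟩ = 0` for every cylindrical `Φ` (e.g. any `u ∈ V` that is an `H`-weak steady solution of
Euler forced by `f`, for which `(u,f) = b(u,u,u) = 0`). -/
def IsDodgerState (f : (UnitAddTorus (Fin 3)) → (EuclideanSpace ℝ (Fin 3))) (u : (Torus.energySpace (Fin 3))) : Prop :=
  Torus.eGradNormSq ((u : Lp (EuclideanSpace ℝ (Fin 3)) 2 (volume : Measure (UnitAddTorus (Fin 3)))) : (UnitAddTorus (Fin 3)) → (EuclideanSpace ℝ (Fin 3))) < ⊤ ∧ 0 ≤ Torus.pairing (u : Lp (EuclideanSpace ℝ (Fin 3)) 2 (volume : Measure (UnitAddTorus (Fin 3)))) f ∧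
    ∀ Φ : Torus.CylindricalTest (Fin 3), Torus.nsGeneratorPairing 0 f u (Φ.grad u) = 0

/-- The Dirac mass at a dodger state is an exact forced-Euler statistics in the sense of the crux. -/
theorem exactEulerStatistics_dirac {f : (UnitAddTorus (Fin 3)) → (EuclideanSpace ℝ (Fin 3))} {u : (Torus.energySpace (Fin 3))} (hu : IsDodgerState f u) :
    ExactEulerStatistics f (Measure.dirac u) := by
  obtain ⟨hG, hW, hgen⟩ := hu
  refine ⟨inferInstance, ?_, ?_, ?_, ?_⟩
  · exact (integrable_const (‖u‖ ^ 2)).congr (ae_eq_dirac (fun v : (Torus.energySpace (Fin 3)) => ‖v‖ ^ 2)).symm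
  · unfold Torus.ensembleEnstrophy
    rwa [lintegral_dirac]
  · intro e₁ e₂ _
    refine integral_nonneg_of_ae (ae_restrict_of_ae ?_)
    filter_upwards [ae_eq_dirac (fun v : (Torus.energySpace (Fin 3)) => Torus.pairing (v : Lp (EuclideanSpace ℝ (Fin 3)) 2 (volume : Measure (UnitAddTorus (Fin 3)))) f)] with v hv
    rw [hv]
    simpa using hW
  · intro Φ
    refine ⟨(integrable_const (Torus.nsGeneratorPairing 0 f u (Φ.grad u))).congr
      (ae_eq_dirac (fun v : (Torus.energySpace (Fin 3)) => Torus.nsGeneratorPairing 0 f v (Φ.grad v))).symm, ?_⟩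
    rw [integral_dirac]
    exact hgen Φ

/-- **Kill switch (states).** One exact dodger state of `f_GP` — of any energy — refutes the crux. -/
theorem not_gpStatisticalRigidity_of_dodgerState (hex : ∃ u : (Torus.energySpace (Fin 3)), IsDodgerState gpForce u) :
    ¬ GPStatisticalRigidity := by
  obtain ⟨u, hu⟩ := hex
  exact not_gpStatisticalRigidity_of_exactEulerStatistics ⟨_, exactEulerStatistics_dirac hu⟩

/-! ## §5 Level bookkeeping -/

/-- Constants valid at level `E` are valid at every lower level. -/
theorem rigidAt_anti {f : (UnitAddTorus (Fin 3)) → (EuclideanSpace ℝ (Fin 3))} {E E' c δ₀ : ℝ} (hEE' : E' ≤ E) (h : RigidAt f E c δ₀) : RigidAt f E' c δ₀ :=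
  fun μ hμ hI hE hG hS R hR0 hRδ hD => h μ hμ hI (hE.trans hEE') hG hS R hR0 hRδ hD

/-- The mean energy of any measure is non-negative. -/
theorem ensembleEnergy_nonneg (μ : Measure (Torus.energySpace (Fin 3))) : 0 ≤ Torus.ensembleEnergy μ :=
  integral_nonneg fun v => by positivity

/-- Negative levels are vacuous (any constants work): `e(μ) ≥ 0`. -/
theorem rigidAt_of_neg {f : (UnitAddTorus (Fin 3)) → (EuclideanSpace ℝ (Fin 3))} {E : ℝ} (hE : E < 0) (c δ₀ : ℝ) : RigidAt f E c δ₀ :=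
  fun μ _ _ hEμ _ _ _ _ _ _ => absurd (hEμ.trans_lt hE) (not_lt.mpr (ensembleEnergy_nonneg μ))

end Summit.AnomalousDissipation.AnomalousDissipation.Theorems.GPStatisticalRigidity.Negative
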